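import Summits.ResolutionOfSingularities.ResolutionOfSingularities.Theorems.HilbertSamuelEliminationCampaignW42RidgeConfinement
import Literature.AlgebraicGeometry.Resolution.PermissibleBlowupHilbertSamuelLocal
import Literature.AlgebraicGeometry.Resolution.HilbertSamuelValues
import HarnessLib

/-!
# [OURS · L1 W4.2] A NEAR point of a permissible blow-up forces EQUALITY all along the Bennett–Hironaka–Singh
# chain: Bennett equality at the line of the fibre cone, the Hironaka–Grothendieck equality at the vertex, and
# `H⁽ᵈ⁻¹⁾(𝒪') = H⁽⁰⁾(𝒪)` (campaign s42, cell res-hironaka; informal crux `RidgeConfinement`,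
# stmt-ResolutionOfSingularities-17845; `--supports`)

HONEST FRAMING. OURS (slot W4.2, prover res-L1-s42-pv-1, gen 3). The tree proves CJS Thm. 3.10 (1) for an ARBITRARY
permissible centre in the local rings (`PermissibleBlowupHilbertSamuelLocal.lean`): for `(𝒪, 𝔫, k)` noetherian local,
`𝔭 = (c_1, …, c_n)` permissible (`𝒪/𝔭` regular of dimension `s`, `𝒪` normally flat along `𝔭`), the chart
`C = 𝒪[𝔭/c_j]` (`Resolution.chartRing c j`), a prime `P ⊆ C` over `𝔫` and `𝒪' = C_P`, one has, for every chain of primes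
of length `ℓ` from `P` and every `i`,
`H⁽ⁱ⁺ˡ⁾(𝒪') ≤ H⁽ⁱ⁺ˡ⁺ˢ⁺¹⁾(𝒪'(X)/𝔫) = H⁽ⁱ⁺ˡ⁺ˢ⁺¹⁾(R_𝔮) ≤ H⁽ⁱ⁺ˡ⁺ˢ⁺¹⁻ᵈ⁾(R) ≤ H⁽ⁱ⁺ˢ⁾(R) ≤ H⁽ⁱ⁾(𝒪)`,
`R = FibreConeLocal 𝔭` the local ring of the fibre cone `C_{X,D,x} = Spec(gr_𝔭 𝒪 ⊗ k)` at its vertex,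
`𝔮 = coneLocalPrime` the prime of `R` through which `x' ↔ P` is read (the line of the cone over `x'`),
`d = dim R/𝔮 ≥ ℓ + 1` (sharp Bennett in `R`), together with `ψ(𝒪) ≤ ψ(𝒪') + ℓ` for a suitable chain. This file adds
the EQUALITY CASE: if `x'` is NEAR at level `N` (`CampaignW42.IsNearRing 𝒪 𝒪' N`:
`H⁽ᴺ⁻ψ(𝒪')⁾(𝒪') = H⁽ᴺ⁻ψ(𝒪)⁾(𝒪)`, the typed OURS nearness of `…CampaignW42RidgeConfinement.lean`, p480040), then every
link is an equality, and after cancelling the common summation index (`iterPSum_injective`):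

* `hilbertSamuelFun_coneLocalPrime_eq_of_isNearRing` — **Bennett EQUALITY at the line of the fibre cone**:
  `H⁽ᵈ⁾(R_𝔮) = H⁽⁰⁾(R)` with `d = dim R/𝔮` (the input of the cone theorem «near non-vertex points of a cone lie on
  the ridge», files `…ConeRidgeClosedPoint` / forthcoming `…ConeRidgePrime`);
* `hilbertSamuelFun_fibreConeLocal_eq_of_isNearRing` — **`H⁽ˢ⁾(R) = H⁽⁰⁾(𝒪)`** (the numerical
  Hironaka–Grothendieck identity `gr_𝔫(𝒪) ≅ (gr_𝔭 𝒪 ⊗ k)[T_1, …, T_s]`, here obtained from nearness);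
* `hilbertSamuelFun_eq_of_isNearRing` — **`H⁽ᵈ⁻¹⁾(𝒪') = H⁽⁰⁾(𝒪)`** and `1 ≤ d` (CJS Thm. 3.10 (2):
  `H⁽ᵟ⁾(𝒪') = H⁽⁰⁾(𝒪)`, with `δ` realised as `d - 1`).

Proof: the tree's three links verbatim, the near hypothesis closing the circle, and `t ↦ H⁽ᵗ⁾(1) = t + edim`
(`hilbertSamuelFun_apply_one`) to identify summation indices. NOTHING here is a statement of H. Hironaka's manuscript
[Hironaka2017]; nothing is asserted about it. AI review is weaker than expert review.

References (orientation only): V. Cossart, U. Jannsen, S. Saito, LNM 2270 (2020), Thm. 2.33, Thm. 3.10 and its proof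
(3.7)–(3.9), (3.14); M. Herrmann, S. Ikeda, U. Orbanz, *Equimultiplicity and Blowing up* (1988), (30.2), (31.1);
B. Singh, Invent. Math. 26 (1974).
-/

noncomputable section

-- single-conjunct summit: the doubled namespace component `ResolutionOfSingularities` is mandated
set_option linter.dupNamespace false

open IsLocalRing
open Literature.RingTheory.HilbertSamuel
open Literature.AlgebraicGeometry.Resolution

namespace Summit.ResolutionOfSingularities.ResolutionOfSingularities.Theorems

namespace CampaignW42

universe u

/-! ## Index bookkeeping for Hilbert–Samuel functions -/

section Index

variable {A : Type u} [CommRing A] [IsLocalRing A] [IsNoetherianRing A]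

/-- `t ↦ H⁽ᵗ⁾_A` is injective (`H⁽ᵗ⁾_A(1) = t + edim A`). [folklore] -/
theorem hilbertSamuelFun_index_injective {a b : ℕ} (h : hilbertSamuelFun A a = hilbertSamuelFun A b) : a = b := by
  have h1 := congr_fun h 1
  rw [hilbertSamuelFun_apply_one, hilbertSamuelFun_apply_one] at h1
  omega

omit [IsNoetherianRing A] in
/-- Cancelling a common summation index: `H⁽ᵗ⁺ᵃ⁾_B = H⁽ᵗ⁺ᵇ⁾_A ⟹ H⁽ᵃ⁾_B = H⁽ᵇ⁾_A`. [folklore] -/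
theorem hilbertSamuelFun_eq_of_add_eq {B : Type u} [CommRing B] [IsLocalRing B] {t a b : ℕ}
    (h : hilbertSamuelFun B (t + a) = hilbertSamuelFun A (t + b)) :
    hilbertSamuelFun B a = hilbertSamuelFun A b := by
  rw [← iterPSum_hilbertSamuelFun B t a, ← iterPSum_hilbertSamuelFun A t b] at h
  exact iterPSum_injective t h

omit [IsNoetherianRing A] in
/-- Shifting an identity of Hilbert–Samuel functions: `H⁽ᵃ⁾_B = H⁽ᵇ⁾_A ⟹ H⁽ᵗ⁺ᵃ⁾_B = H⁽ᵗ⁺ᵇ⁾_A`. [folklore] -/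
theorem hilbertSamuelFun_add_eq_of_eq {B : Type u} [CommRing B] [IsLocalRing B] {a b : ℕ}
    (h : hilbertSamuelFun B a = hilbertSamuelFun A b) (t : ℕ) :
    hilbertSamuelFun B (t + a) = hilbertSamuelFun A (t + b) := by
  rw [← iterPSum_hilbertSamuelFun B t a, ← iterPSum_hilbertSamuelFun A t b, h]

end Index

/-! ## The chart of a permissible blow-up at a near point -/

section Chart

variable {O : Type u} [CommRing O] [IsLocalRing O] [IsNoetherianRing O] {n : ℕ} (c : Fin n → O)
  (j : Fin n)

local notation3 "𝔭" => Ideal.span (Set.range c)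
local notation3 "hcj" => Ideal.mem_span_range_self (f := c) (x := j)

variable (P : Ideal (chartRing c j)) [P.IsPrime]
variable (O' : Type u) [CommRing O'] [Algebra (chartRing c j) O'] [IsLocalization.AtPrime O' P]
  [IsLocalRing O'] [Algebra O O']

/-- **All links of the Bennett–Hironaka–Singh chain are equalities at a near point.** With the notation of the
module docstring: if `𝒪'` is near to `𝒪` at level `N`, then `d = dim R/𝔮` satisfies `1 ≤ d`,
`H⁽ᵈ⁾(R_𝔮) = H⁽⁰⁾(R)` (Bennett equality at the line of the fibre cone), `H⁽ˢ⁾(R) = H⁽⁰⁾(𝒪)` (vertex) and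
`H⁽ᵈ⁻¹⁾(𝒪') = H⁽⁰⁾(𝒪)`. [cite: CossartJannsenSaito2020, Thm. 3.10 (proof, (3.14))] -/
theorem near_chain_equalities (hO : IsUniversallyCatenaryRing O) [(𝔭).IsPrime]
    [IsRegularLocalRing (O ⧸ 𝔭)] {s : ℕ} (hs : ringKrullDim (O ⧸ 𝔭) = s) (hNF : (𝔭).IsNormallyFlat)
    (hP : P.comap (chartBase c j) = maximalIdeal O)
    (hOO' : ∀ r : O, algebraMap O O' r = (algebraMap (chartRing c j) O' : chartRing c j →+* O') (chartBase c j r))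
    {N : ℕ} (hnear : IsNearRing O O' N)
    {d : ℕ} (hd : haveI := isPrime_coneLocalPrime (c j) hcj P hP
      ringKrullDim (FibreConeLocal (𝔭) ⧸ coneLocalPrime (c j) hcj P) = d) :
    haveI := isPrime_coneLocalPrime (c j) hcj P hP
    1 ≤ d ∧
    hilbertSamuelFun (Localization.AtPrime (coneLocalPrime (c j) hcj P)) d =
      hilbertSamuelFun (FibreConeLocal (𝔭)) 0 ∧
    hilbertSamuelFun (FibreConeLocal (𝔭)) s = hilbertSamuelFun O 0 ∧
    hilbertSamuelFun O' (d - 1) = hilbertSamuelFun O 0 := by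
  haveI hq := isPrime_coneLocalPrime (c j) hcj P hP
  haveI := isLocalRing_localizedPolynomial_quotient (c j) hcj P O' hP hOO'
  haveI := isNoetherianRing_chart c j
  haveI : IsNoetherianRing O' := IsLocalization.isNoetherianRing P.primeCompl O' inferInstance
  obtain ⟨x, hx⟩ := exists_maximalIdeal_eq_sup_span_range (𝔭) hs
  set R := FibreConeLocal (𝔭)
  set q := coneLocalPrime (c j) hcj P
  -- the chain with `ψ(𝒪) ≤ ψ(𝒪') + ℓ`
  obtain ⟨t, ht, hψ⟩ := exists_ltSeries_minimalPrimesCodim_le c j P O' hO hP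
  set ℓ := t.length
  set i := N - minimalPrimesCodim O
  -- (0) near: `H[𝒪](i) = H[𝒪'](N - ψ') ≤ H[𝒪'](i + ℓ)`
  have h0 : hilbertSamuelFun O i ≤ hilbertSamuelFun O' (i + ℓ) := by
    have h := hilbertSamuelFun_mono (A := O') (show N - minimalPrimesCodim O' ≤ i + ℓ by omega)
    unfold IsNearRing at hnear
    rw [hnear] at h
    exact h
  -- (1) `H[𝒪'](i+ℓ) ≤ H[R_q](i+ℓ+s+1)`
  have h1 := hilbertSamuelFun_le_localizedPolynomial_quotient c j P O' hP hOO' x hx (i + ℓ)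
  rw [hilbertSamuelFun_localizedPolynomial_quotient_eq (c j) hcj P O' hP hOO'] at h1
  -- (2) Bennett in `R` at `q`, `d ≥ ℓ + 1`
  have hℓd : ℓ + 1 ≤ d := by
    have h := length_succ_le_ringKrullDim_fibreConeLocal_quotient (c j) hcj P hP t ht
    rw [hd] at h
    exact_mod_cast h
  have hG : IsGRing R := isGRing_fibreConeLocal (𝔭)
  have hB : ∀ s', hilbertSamuelFun (Localization.AtPrime q) (s' + d) ≤ hilbertSamuelFun R s' :=
    hilbertSamuelFun_add_le_of_ringKrullDim_quotient_eq_of_ringHom_field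
      (fibreConeLocalResidueMap (𝔭)) (fun q' Q _ _ hqQ hadj _ =>
        module_finite_integralClosure_range_localization_quotient_of_isGRing hG Q _
          (ringKrullDim_localization_quotient_map_eq_one hqQ hadj)) d q hd
  have h2a : hilbertSamuelFun (Localization.AtPrime q) (i + ℓ + (s + 1)) ≤
      hilbertSamuelFun (Localization.AtPrime q) ((i + ℓ + (s + 1) - d) + d) :=
    hilbertSamuelFun_mono (by omega)
  have h2b : hilbertSamuelFun (Localization.AtPrime q) ((i + ℓ + (s + 1) - d) + d) ≤
      hilbertSamuelFun R (i + ℓ + (s + 1) - d) := hB _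
  have h2c : hilbertSamuelFun R (i + ℓ + (s + 1) - d) ≤ hilbertSamuelFun R (i + s) :=
    hilbertSamuelFun_mono (by omega)
  -- (3) the vertex
  have h3 := hilbertSamuelFun_fibreConeLocal_add_le (𝔭) hs hNF i
  -- closing the circle: every link is an equality
  have e3 : hilbertSamuelFun R (i + s) = hilbertSamuelFun O i :=
    le_antisymm h3 (h0.trans (h1.trans (h2a.trans (h2b.trans h2c))))
  have e2c : hilbertSamuelFun R (i + ℓ + (s + 1) - d) = hilbertSamuelFun R (i + s) :=
    le_antisymm h2c (by rw [e3]; exact h0.trans (h1.trans (h2a.trans h2b)))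
  have e2b : hilbertSamuelFun (Localization.AtPrime q) ((i + ℓ + (s + 1) - d) + d) =
      hilbertSamuelFun R (i + ℓ + (s + 1) - d) :=
    le_antisymm h2b (by rw [e2c, e3]; exact h0.trans (h1.trans h2a))
  have e2a : hilbertSamuelFun (Localization.AtPrime q) (i + ℓ + (s + 1)) =
      hilbertSamuelFun (Localization.AtPrime q) ((i + ℓ + (s + 1) - d) + d) :=
    le_antisymm h2a (by rw [e2b, e2c, e3]; exact h0.trans h1)
  have e1 : hilbertSamuelFun O' (i + ℓ) = hilbertSamuelFun (Localization.AtPrime q) (i + ℓ + (s + 1)) :=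
    le_antisymm h1 (by rw [e2a, e2b, e2c, e3]; exact h0)
  -- `d = ℓ + 1`
  have hidx1 := hilbertSamuelFun_index_injective e2c
  have hidx2 := hilbertSamuelFun_index_injective e2a
  have hdℓ : d = ℓ + 1 := by omega
  refine ⟨by omega, ?_, ?_, ?_⟩
  · -- Bennett equality: cancel the index `i + s`
    have h : hilbertSamuelFun (Localization.AtPrime q) ((i + s) + d) = hilbertSamuelFun R ((i + s) + 0) := by
      rw [add_zero, ← e2c, ← e2b]
      congr 1
      omega
    exact hilbertSamuelFun_eq_of_add_eq h
  · -- vertex: cancel the index `i`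
    have h : hilbertSamuelFun R (i + s) = hilbertSamuelFun O (i + 0) := by rw [add_zero]; exact e3
    exact hilbertSamuelFun_eq_of_add_eq h
  · -- `H⁽ˡ⁾(𝒪') = H⁽⁰⁾(𝒪)`
    have h : hilbertSamuelFun O' (i + (d - 1)) = hilbertSamuelFun O (i + 0) := by
      rw [add_zero, show d - 1 = ℓ by omega, e1, e2a, e2b, e2c, e3]
    exact hilbertSamuelFun_eq_of_add_eq h

/-- **Bennett EQUALITY at the line of the fibre cone over a near point**: `H⁽ᵗ⁺ᵈ⁾(R_𝔮) = H⁽ᵗ⁾(R)` for all `t`,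
`R = FibreConeLocal 𝔭` the local ring of the fibre cone at its vertex, `𝔮 = coneLocalPrime` the prime attached to the
near point, `d = dim R/𝔮 ≥ 1`. [cite: CossartJannsenSaito2020, Thm. 3.10 (proof, (3.14))] -/
theorem hilbertSamuelFun_coneLocalPrime_eq_of_isNearRing (hO : IsUniversallyCatenaryRing O) [(𝔭).IsPrime]
    [IsRegularLocalRing (O ⧸ 𝔭)] (hNF : (𝔭).IsNormallyFlat)
    (hP : P.comap (chartBase c j) = maximalIdeal O)
    (hOO' : ∀ r : O, algebraMap O O' r = (algebraMap (chartRing c j) O' : chartRing c j →+* O') (chartBase c j r))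
    {N : ℕ} (hnear : IsNearRing O O' N)
    {d : ℕ} (hd : haveI := isPrime_coneLocalPrime (c j) hcj P hP
      ringKrullDim (FibreConeLocal (𝔭) ⧸ coneLocalPrime (c j) hcj P) = d) (t : ℕ) :
    haveI := isPrime_coneLocalPrime (c j) hcj P hP
    hilbertSamuelFun (Localization.AtPrime (coneLocalPrime (c j) hcj P)) (t + d) =
      hilbertSamuelFun (FibreConeLocal (𝔭)) t := by
  obtain ⟨s, hs⟩ := exists_ringKrullDim_quotient_eq_nat O (𝔭)
  have h := (near_chain_equalities c j P O' hO hs hNF hP hOO' hnear hd).2.1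
  have h' := hilbertSamuelFun_add_eq_of_eq h t
  rwa [add_zero] at h'

/-- `1 ≤ dim R/𝔮` (the vertex is a proper specialisation of the line). [folklore] -/
theorem one_le_of_isNearRing (hO : IsUniversallyCatenaryRing O) [(𝔭).IsPrime]
    [IsRegularLocalRing (O ⧸ 𝔭)] (hNF : (𝔭).IsNormallyFlat)
    (hP : P.comap (chartBase c j) = maximalIdeal O)
    (hOO' : ∀ r : O, algebraMap O O' r = (algebraMap (chartRing c j) O' : chartRing c j →+* O') (chartBase c j r))
    {N : ℕ} (hnear : IsNearRing O O' N)
    {d : ℕ} (hd : haveI := isPrime_coneLocalPrime (c j) hcj P hP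
      ringKrullDim (FibreConeLocal (𝔭) ⧸ coneLocalPrime (c j) hcj P) = d) : 1 ≤ d := by
  obtain ⟨s, hs⟩ := exists_ringKrullDim_quotient_eq_nat O (𝔭)
  exact (near_chain_equalities c j P O' hO hs hNF hP hOO' hnear hd).1

/-- **The Hironaka–Grothendieck equality at the vertex, from nearness**: `H⁽ᵗ⁺ˢ⁾(R) = H⁽ᵗ⁾(𝒪)` for all `t`,
`s = dim 𝒪/𝔭` (numerically: `gr_𝔫(𝒪)` has the Hilbert function of `(gr_𝔭 𝒪 ⊗ k)[T_1, …, T_s]`).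
[cite: HerrmannIkedaOrbanz1988, Thm. (31.1) (proof, (8))] -/
theorem hilbertSamuelFun_fibreConeLocal_eq_of_isNearRing (hO : IsUniversallyCatenaryRing O) [(𝔭).IsPrime]
    [IsRegularLocalRing (O ⧸ 𝔭)] {s : ℕ} (hs : ringKrullDim (O ⧸ 𝔭) = s) (hNF : (𝔭).IsNormallyFlat)
    (hP : P.comap (chartBase c j) = maximalIdeal O)
    (hOO' : ∀ r : O, algebraMap O O' r = (algebraMap (chartRing c j) O' : chartRing c j →+* O') (chartBase c j r))
    {N : ℕ} (hnear : IsNearRing O O' N) (t : ℕ) :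
    hilbertSamuelFun (FibreConeLocal (𝔭)) (t + s) = hilbertSamuelFun O t := by
  haveI := isPrime_coneLocalPrime (c j) hcj P hP
  obtain ⟨d, hd⟩ := exists_ringKrullDim_quotient_eq_nat (FibreConeLocal (𝔭)) (coneLocalPrime (c j) hcj P)
  have h := (near_chain_equalities c j P O' hO hs hNF hP hOO' hnear hd).2.2.1
  have h' := hilbertSamuelFun_add_eq_of_eq h t
  rwa [add_zero] at h'

/-- **CJS Thm. 3.10 (2) at a near point, local rings**: `H⁽ᵗ⁺ᵈ⁻¹⁾(𝒪') = H⁽ᵗ⁾(𝒪)` for all `t`, where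
`d = dim R/𝔮 ≥ 1` (`d - 1` realises `δ = trdeg κ(x')/κ(x)`). [cite: CossartJannsenSaito2020, Thm. 3.10 (2)] -/
theorem hilbertSamuelFun_eq_of_isNearRing (hO : IsUniversallyCatenaryRing O) [(𝔭).IsPrime]
    [IsRegularLocalRing (O ⧸ 𝔭)] (hNF : (𝔭).IsNormallyFlat)
    (hP : P.comap (chartBase c j) = maximalIdeal O)
    (hOO' : ∀ r : O, algebraMap O O' r = (algebraMap (chartRing c j) O' : chartRing c j →+* O') (chartBase c j r))
    {N : ℕ} (hnear : IsNearRing O O' N)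
    {d : ℕ} (hd : haveI := isPrime_coneLocalPrime (c j) hcj P hP
      ringKrullDim (FibreConeLocal (𝔭) ⧸ coneLocalPrime (c j) hcj P) = d) (t : ℕ) :
    hilbertSamuelFun O' (t + (d - 1)) = hilbertSamuelFun O t := by
  obtain ⟨s, hs⟩ := exists_ringKrullDim_quotient_eq_nat O (𝔭)
  have h := (near_chain_equalities c j P O' hO hs hNF hP hOO' hnear hd).2.2.2
  have h' := hilbertSamuelFun_add_eq_of_eq h t
  rwa [add_zero] at h'

end Chart

end CampaignW42

end Summit.ResolutionOfSingularities.ResolutionOfSingularities.Theorems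

end
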